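import Summits.NavierStokesRegularity.FunctionalMining.NoGo.SpiralJetStretching
import Summits.NavierStokesRegularity.FunctionalMining.MiddleEigenvalueMomentDoorReal
import Summits.NavierStokesRegularity.FunctionalMining.VorticityL4Pointwise
import HarnessLib

/-!
# K1-Q2 all-`q` kill-all, part 4: `∫ (|ω|²)^r σ > 0` for every real `r > 0`; every constant refuted

Search for candidate a priori estimates; no regularity claim. NS FUNCTIONAL MINING — NO-GO BRANCH
(cell `pub-nsfunc`, prove seat gen 13). **THEOREM (kernel): for EVERY real `q > 2` and EVERY `C`,
`MiddleEigenvalueMomentRateBound q C` is FALSE on `T³`** (`middleEigenvalueMomentRate_killAll_rpow`)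
— the K1-Q2 family `{dZ_q/dt ≤ C‖λ₂⁺(S)‖_∞ Z_q : q ≥ 2}` has exactly one true member, `q = 2`
(tree `middleEigenvalueMomentRateBound_two`); K0 rows `E.q|T_C|C3b`, `q ∈ {5/2, 3, 10/3, 4, 5, 6}`
(the no-go seat's N11(k), there a paper theorem with two nested asymptotics; kernel instances
`q = 4, 6` in `NoGo/MiddleEigenvalueKillAll{Witness,Six}`). ONE fixed explicit field, no asymptotics:
the spiral-jet witness `sfld` (parts 1–3) has `λ₂(S) ≡ 0` (`middle_nonpos_sfld`) and, for every real
`r > 0`, `∫_{T³} (|ω|²)^r σ > 0` (`integral_moment_pos`):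

1. `z`-symmetrisation: the angle reflection `reflT 2` preserves the volume of `T³`
   (`measurePreserving_reflT`, Haar measure on the abelian compact group `UnitAddCircle` is negation
   invariant) and turns `(|ω|²)^rσ = (A0+X2+2X1)^r S1` into `(A0+X2−2X1)^r(−S1)` (part 3), so
   `2∫(|ω|²)^rσ = ∫ D`, `D = [(A0+X2+2X1)^r − (A0+X2−2X1)^r]·S1`;
2. `S1 = Scoll + 8V s ψf′(s) X1` (part 3): the collar part `[(…)^r − (…)^r]·Scoll` is ODD under
   `reflT 0` (`Gcoll_reflT_zero`), so its integral vanishes; the plateau part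
   `[(B+)^r − (B−)^r]·8V s ψf′ X1` is pointwise `≥ 0` (both bases are sums of squares, `t ↦ t^r` is
   monotone, and the bracket has the sign of `X1`; `V, s, ψf′ ≥ 0`);
3. positivity: at the cube point over `(p, q) = √s⋆·(df s⋆, cf s⋆)`, `z = 1/4`, with `ψf′(s⋆) = 16π`
   (part 1, mean value theorem), the plateau density is `> 0`; it is continuous on `ℝ³`, so its
   integral over the unit cube (`= ∫_{T³}` by `integral_comp_repr`) is positive.

The door `middleEigenvalueMomentRateFailsReal_of_nonpos_middle` (tree, `q ≥ 2`) then refutes every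
constant. Nothing about Navier–Stokes regularity is asserted: these are static field facts refuting
one family of candidate a priori inequalities.
-/

noncomputable section

open MeasureTheory Set Function Filter Topology Metric
open scoped ContDiff Real

namespace Summit.NavierStokesRegularity.FunctionalMining

namespace SpiralJet

open Literature.Analysis.FunctionSpaces Literature.Analysis.FunctionSpaces.Torus
  Literature.Analysis.FluidPDE KillAll VorticityL4

/-! ## 1. The angle reflections preserve the volume -/

/-- `reflT k` as a measurable equivalence (an involution). [ours, bookkeeping] -/
def reflTEquiv (k : Fin 3) : UnitAddTorus (Fin 3) ≃ᵐ UnitAddTorus (Fin 3) where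
  toFun := reflT k
  invFun := reflT k
  left_inv := reflT_reflT k
  right_inv := reflT_reflT k
  measurable_toFun := (continuous_reflT k).measurable
  measurable_invFun := (continuous_reflT k).measurable

/-- **`reflT k` preserves the volume of `T³`** (product of Haar measures; negation preserves the Haar
measure of the compact abelian group `UnitAddCircle`). [folklore] -/
theorem measurePreserving_reflT (k : Fin 3) : MeasurePreserving (reflT k) volume volume := by
  have h := MeasureTheory.volume_preserving_pi (α' := fun _ : Fin 3 => UnitAddCircle)
    (β' := fun _ : Fin 3 => UnitAddCircle)
    (f := fun i => if i = k then (fun x : UnitAddCircle => -x) else id) (fun i => by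
      by_cases hi : i = k
      · simp only [hi, if_true]; exact Measure.measurePreserving_neg (volume : Measure UnitAddCircle)
      · simp only [hi, if_false]; exact MeasurePreserving.id volume)
  have e : reflT k = fun a i => (if i = k then (fun x : UnitAddCircle => -x) else id) (a i) := by
    funext ξ i
    simp only [reflT]
    split_ifs <;> rfl
  rw [e]
  exact h

/-- Change of variables under `reflT k`: `∫ g ∘ reflT k = ∫ g`. [folklore] -/
theorem integral_comp_reflT (k : Fin 3) (g : UnitAddTorus (Fin 3) → ℝ) :
    ∫ ξ, g (reflT k ξ) = ∫ ξ, g ξ :=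
  (measurePreserving_reflT k).integral_comp (reflTEquiv k).measurableEmbedding g

/-! ## 2. The symmetrised densities -/

/-- The bracket `(A0+X2+2X1)^r − (A0+X2−2X1)^r`. [ours] -/
def bracket (r : ℝ) (y : E3) : ℝ :=
  (A0 y + X2 y + 2 * X1 y) ^ r - (A0 y + X2 y - 2 * X1 y) ^ r

/-- The plateau density `Dplat = bracket · 8 V s ψf′(s) X1`. [ours] -/
def Dplat (r : ℝ) (y : E3) : ℝ := bracket r y * (8 * Vz (y 2) * rs y * deriv ψf (rs y) * X1 y)

/-- The collar density `Gcoll = bracket · Scoll`. [ours] -/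
def Gcoll (r : ℝ) (y : E3) : ℝ := bracket r y * Scoll y

/-- **The bracket has the sign of `X1`**: `0 ≤ bracket · X1` (both bases are `≥ 0`, `t ↦ t^r` is
monotone for `r ≥ 0`). [ours] -/
theorem bracket_mul_X1_nonneg {r : ℝ} (hr : 0 ≤ r) (y : E3) : 0 ≤ bracket r y * X1 y := by
  have hp := base_plus_nonneg y
  have hm := base_minus_nonneg y
  unfold bracket
  rcases le_or_gt 0 (X1 y) with hx | hx
  · have hle : A0 y + X2 y - 2 * X1 y ≤ A0 y + X2 y + 2 * X1 y := by linarith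
    have h := Real.rpow_le_rpow hm hle hr
    exact mul_nonneg (by linarith) hx
  · have hle : A0 y + X2 y + 2 * X1 y ≤ A0 y + X2 y - 2 * X1 y := by linarith
    have h := Real.rpow_le_rpow hp hle hr
    exact mul_nonneg_of_nonpos_of_nonpos (by linarith) hx.le

/-- **`Dplat ≥ 0` everywhere.** [ours] -/
theorem Dplat_nonneg {r : ℝ} (hr : 0 ≤ r) (y : E3) : 0 ≤ Dplat r y := by
  have h1 := bracket_mul_X1_nonneg hr y
  have h2 : 0 ≤ 8 * Vz (y 2) * rs y * deriv ψf (rs y) :=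
    mul_nonneg (mul_nonneg (mul_nonneg (by norm_num) (Vz_nonneg _)) (rs_nonneg y)) (deriv_ψf_nonneg _)
  have e : Dplat r y = (bracket r y * X1 y) * (8 * Vz (y 2) * rs y * deriv ψf (rs y)) := by
    unfold Dplat; ring
  rw [e]; exact mul_nonneg h1 h2

/-- `Fe + Fm = Gcoll + Dplat`: the symmetrised moment density splits into collar and plateau parts.
[ours] -/
theorem symmetrised_eq (r : ℝ) (y : E3) :
    (A0 y + 2 * X1 y + X2 y) ^ r * S1 y + (A0 y + X2 y - 2 * X1 y) ^ r * (-S1 y) =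
      Gcoll r y + Dplat r y := by
  rw [show A0 y + 2 * X1 y + X2 y = A0 y + X2 y + 2 * X1 y by ring, S1_eq]
  unfold Gcoll Dplat bracket
  ring

/-! ## 3. Continuity of the densities on `ℝ³` -/

/-- The coordinate maps are continuous. [folklore] -/
private theorem continuous_coord (a : Fin 3) : Continuous (fun y : E3 => y a) :=
  (EuclideanSpace.proj a : E3 →L[ℝ] ℝ).continuous

/-- `J2x`, `J2y` are continuous. [ours, bookkeeping] -/
theorem continuous_J2xy : Continuous J2x ∧ Continuous J2y := by
  have hpc := contDiff_pc.continuous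
  have hqc := contDiff_qc.continuous
  have hrs := contDiff_rs.continuous
  have hk : Continuous fun y => kf (rs y) := contDiff_kf.continuous.comp hrs
  have hk' : Continuous fun y => deriv kf (rs y) := (contDiff_kf.continuous_deriv (by simp)).comp hrs
  have hc : Continuous fun y => cf (rs y) := contDiff_cf.continuous.comp hrs
  have hd : Continuous fun y => df (rs y) := contDiff_df.continuous.comp hrs
  have hψ' : Continuous fun y => deriv ψf (rs y) := (contDiff_ψf.continuous_deriv (by simp)).comp hrs
  constructor
  · unfold J2x; fun_prop
  · unfold J2y; fun_prop

/-- `A0, X1, X2, S1, Scoll` are continuous. [ours, bookkeeping] -/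
theorem continuous_densities :
    Continuous A0 ∧ Continuous X1 ∧ Continuous X2 ∧ Continuous S1 ∧ Continuous Scoll := by
  obtain ⟨hx, hy⟩ := continuous_J2xy
  have hpc := contDiff_pc.continuous
  have hqc := contDiff_qc.continuous
  have hrs := contDiff_rs.continuous
  have hV : Continuous fun y : E3 => Vz (y 2) := continuous_Vz.comp (continuous_coord 2)
  have hdV : Continuous fun y : E3 => dVz (y 2) := continuous_dVz.comp (continuous_coord 2)
  have hk : Continuous fun y => kf (rs y) := contDiff_kf.continuous.comp hrs
  have hk' : Continuous fun y => deriv kf (rs y) := (contDiff_kf.continuous_deriv (by simp)).comp hrs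
  have hc : Continuous fun y => cf (rs y) := contDiff_cf.continuous.comp hrs
  have hd : Continuous fun y => df (rs y) := contDiff_df.continuous.comp hrs
  refine ⟨?_, ?_, ?_, ?_, ?_⟩
  · unfold A0; fun_prop
  · unfold X1; fun_prop
  · unfold X2; fun_prop
  · unfold S1; fun_prop
  · unfold Scoll; fun_prop

/-- `bracket r` is continuous for `r > 0`. [ours, bookkeeping] -/
theorem continuous_bracket {r : ℝ} (hr : 0 < r) : Continuous (bracket r) := by
  obtain ⟨hA, hX1, hX2, -, -⟩ := continuous_densities
  unfold bracket
  exact (((hA.add hX2).add (continuous_const.mul hX1)).rpow_const fun y => Or.inr hr.le).sub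
    (((hA.add hX2).sub (continuous_const.mul hX1)).rpow_const fun y => Or.inr hr.le)

/-- `Dplat r` and `Gcoll r` are continuous for `r > 0`. [ours, bookkeeping] -/
theorem continuous_Dplat_Gcoll {r : ℝ} (hr : 0 < r) : Continuous (Dplat r) ∧ Continuous (Gcoll r) := by
  obtain ⟨-, hX1, -, -, hS⟩ := continuous_densities
  have hb := continuous_bracket hr
  have hrs := contDiff_rs.continuous
  have hV : Continuous fun y : E3 => Vz (y 2) := continuous_Vz.comp (continuous_coord 2)
  have hψ' : Continuous fun y => deriv ψf (rs y) := (contDiff_ψf.continuous_deriv (by simp)).comp hrs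
  constructor
  · unfold Dplat; fun_prop
  · unfold Gcoll; fun_prop

/-! ## 4. A point of positive plateau density and the positivity of its integral -/

/-- `Vz(1/4) = 1`, `Vz′(1/4) = 2π`. [folklore] -/
theorem Vz_quarter : Vz (1 / 4) = 1 ∧ dVz (1 / 4) = 2 * π := by
  have e : 2 * π * (1 / 4 : ℝ) = π / 2 := by ring
  refine ⟨?_, ?_⟩
  · unfold Vz; rw [e, Real.cos_pi_div_two]; norm_num
  · unfold dVz; rw [e, Real.sin_pi_div_two]; ring

/-- **A point where the plateau density is positive.** [ours] -/
theorem exists_Dplat_pos {r : ℝ} (hr : 0 < r) :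
    ∃ y : E3, (∀ i, y i ∈ Ioo (1 / 8 : ℝ) (7 / 8)) ∧ 0 < Dplat r y := by
  obtain ⟨s, hs1, hs2, hψ⟩ := exists_deriv_ψf_pos
  have hs0 : 0 < s := by linarith
  set ρ := Real.sqrt s with hρ
  have hρ0 : 0 < ρ := Real.sqrt_pos.2 hs0
  have hρs : ρ ^ 2 = s := Real.sq_sqrt hs0.le
  have hρle : ρ < 5 / 16 := by
    rw [hρ, show (5 / 16 : ℝ) = Real.sqrt ((5 / 16) ^ 2) by rw [Real.sqrt_sq (by norm_num)]]
    exact Real.sqrt_lt_sqrt hs0.le (by nlinarith)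
  -- the point
  set y : E3 := WithLp.toLp 2 ![ρ * df s + 1 / 2, ρ * cf s + 1 / 2, 1 / 4] with hy
  have hy0 : y 0 = ρ * df s + 1 / 2 := by simp [hy]
  have hy1 : y 1 = ρ * cf s + 1 / 2 := by simp [hy]
  have hy2 : y 2 = 1 / 4 := by simp [hy]
  have hpc : pc y = ρ * df s := by simp only [pc, sh, hy0]; ring
  have hqc : qc y = ρ * cf s := by simp only [qc, sh, hy1]; ring
  have hcd := cf_sq_add_df_sq s
  have hrs : rs y = s := by
    simp only [rs, hpc, hqc]; nlinarith [hρs, hcd]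
  have hdf : |df s| ≤ 1 := Real.abs_sin_le_one _
  have hcf : |cf s| ≤ 1 := Real.abs_cos_le_one _
  refine ⟨y, ?_, ?_⟩
  · intro i
    fin_cases i
    · show y 0 ∈ Ioo (1 / 8 : ℝ) (7 / 8)
      rw [hy0]
      have : |ρ * df s| ≤ ρ * 1 := by rw [abs_mul, abs_of_pos hρ0]; exact mul_le_mul_of_nonneg_left hdf hρ0.le
      constructor <;> nlinarith [abs_le.1 this]
    · show y 1 ∈ Ioo (1 / 8 : ℝ) (7 / 8)
      rw [hy1]
      have : |ρ * cf s| ≤ ρ * 1 := by rw [abs_mul, abs_of_pos hρ0]; exact mul_le_mul_of_nonneg_left hcf hρ0.le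
      constructor <;> nlinarith [abs_le.1 this]
    · show y 2 ∈ Ioo (1 / 8 : ℝ) (7 / 8)
      rw [hy2]; constructor <;> norm_num
  · -- the value: `X1 = 2π`, bracket `> 0`, prefactor `8 · 1 · s · 16π > 0`
    obtain ⟨hB1, -, -, -⟩ := plateau_of_deriv_ψf_ne_zero (s := s) (by rw [hψ]; positivity)
    obtain ⟨hV, hdV⟩ := Vz_quarter
    have hkf : kf s = ρ⁻¹ := by simp [kf, hB1, hρ]
    have hX1 : X1 y = 2 * π := by
      rw [X1_eq, hy2, hdV, hrs, hkf, hpc, hqc]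
      have : ρ * df s * df s + ρ * cf s * cf s = ρ := by nlinarith [hcd]
      rw [this]; field_simp
    have hX1pos : 0 < X1 y := by rw [hX1]; positivity
    have hbr : 0 < bracket r y := by
      unfold bracket
      have hm := base_minus_nonneg y
      have hlt : A0 y + X2 y - 2 * X1 y < A0 y + X2 y + 2 * X1 y := by linarith
      have h := Real.rpow_lt_rpow hm hlt hr
      linarith
    unfold Dplat
    rw [hy2, hV, hrs, hψ, hX1]
    positivity

/-- The lower face box `{y | 1/8 < yᵢ < 7/8}` lies in the unit cube, with a ball around each point. [folklore] -/
theorem ball_subset_unitCube {y : E3} (hy : ∀ i, y i ∈ Ioo (1 / 8 : ℝ) (7 / 8)) :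
    ball y (1 / 8) ⊆ unitCube (Fin 3) := by
  intro z hz
  rw [mem_unitCube]
  intro i
  have h1 : |z i - y i| < 1 / 8 := by
    have h := PiLp.norm_apply_le (z - y) i
    rw [mem_ball, dist_eq_norm] at hz
    simpa [Real.norm_eq_abs] using lt_of_le_of_lt h hz
  have h2 := hy i
  constructor <;> nlinarith [abs_lt.1 h1, h2.1, h2.2]

/-- **`0 < ∫_{unit cube} Dplat`.** [ours] -/
theorem setIntegral_Dplat_pos {r : ℝ} (hr : 0 < r) : 0 < ∫ y in unitCube (Fin 3), Dplat r y := by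
  obtain ⟨y, hy, hpos⟩ := exists_Dplat_pos hr
  have hc := (continuous_Dplat_Gcoll hr).1
  -- a ball on which `Dplat ≥ Dplat y / 2`
  obtain ⟨δ, hδ, hδP⟩ := Metric.continuousAt_iff.1 hc.continuousAt (Dplat r y / 2) (by linarith)
  set δ' := min δ (1 / 8) with hδ'
  have hδ'0 : 0 < δ' := lt_min hδ (by norm_num)
  have hsub : ball y δ' ⊆ unitCube (Fin 3) :=
    (ball_subset_ball (min_le_right _ _)).trans (ball_subset_unitCube hy)
  have hlow : ∀ z ∈ ball y δ', Dplat r y / 2 ≤ Dplat r z := by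
    intro z hz
    have h := hδP (lt_of_lt_of_le (mem_ball.1 hz) (min_le_left _ _))
    rw [Real.dist_eq, abs_lt] at h
    linarith [h.1]
  have hball : volume.real (ball y δ') ≠ 0 := by
    have h := (measure_ball_pos (volume : Measure E3) y hδ'0).ne'
    rw [Measure.real, ENNReal.toReal_ne_zero]
    exact ⟨h, measure_ball_lt_top.ne⟩
  have hballpos : 0 < volume.real (ball y δ') := lt_of_le_of_ne measureReal_nonneg (Ne.symm hball)
  have hint : IntegrableOn (Dplat r) (ball y δ') volume := (integrableOn_unitCube hc).mono_set hsub
  have h1 : Dplat r y / 2 * volume.real (ball y δ') ≤ ∫ z in ball y δ', Dplat r z :=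
    setIntegral_ge_of_const_le_real measurableSet_ball measure_ball_lt_top.ne hlow hint
  have h2 : ∫ z in ball y δ', Dplat r z ≤ ∫ z in unitCube (Fin 3), Dplat r z :=
    setIntegral_mono_set (integrableOn_unitCube hc) (ae_of_all _ fun z => Dplat_nonneg hr.le z)
      (ae_of_all _ hsub)
  have h3 : 0 < Dplat r y / 2 * volume.real (ball y δ') := by positivity
  linarith

/-! ## 5. `∫ (|ω|²)^r σ > 0` -/

/-- **The weighted stretching moment of the spiral-jet witness is positive for every real `r > 0`:**
`0 < ∫_{T³} (|ω|²)^r σ`. [ours] -/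
theorem integral_moment_pos {r : ℝ} (hr : 0 < r) :
    0 < ∫ ξ : UnitAddTorus (Fin 3), torusVorticitySqAt sfld ξ ^ r * torusStretchingDensity sfld ξ := by
  set F : UnitAddTorus (Fin 3) → ℝ := fun ξ =>
    torusVorticitySqAt sfld ξ ^ r * torusStretchingDensity sfld ξ with hF
  -- continuity / integrability on the torus
  have hQ : Continuous (torusVorticitySqAt sfld) := continuous_vorticitySqAt isSmooth_sfld
  have hσ : Continuous (torusStretchingDensity sfld) := continuous_stretchingDensity isSmooth_sfld
  have hFc : Continuous F :=
    (hQ.rpow_const fun ξ => Or.inr hr.le).mul hσ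
  have hFi : Integrable F := hFc.integrable_unitAddTorus
  have hFri : Integrable (fun ξ => F (reflT 2 ξ)) := (hFc.comp (continuous_reflT 2)).integrable_unitAddTorus
  obtain ⟨hDc, hGc⟩ := continuous_Dplat_Gcoll hr
  have hDi : Integrable (fun ξ : UnitAddTorus (Fin 3) => Dplat r (repr ξ)) :=
    integrable_comp_repr (integrableOn_unitCube hDc)
  have hGi : Integrable (fun ξ : UnitAddTorus (Fin 3) => Gcoll r (repr ξ)) :=
    integrable_comp_repr (integrableOn_unitCube hGc)
  -- (1) symmetrisation: `∫ F = ∫ F ∘ reflT 2`, and `F + F ∘ reflT 2 = (Gcoll + Dplat) ∘ repr`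
  have hsym : ∫ ξ, F ξ = ∫ ξ, F (reflT 2 ξ) := (integral_comp_reflT 2 F).symm
  have hsum : ∀ ξ, F ξ + F (reflT 2 ξ) = Gcoll r (repr ξ) + Dplat r (repr ξ) := by
    intro ξ
    simp only [hF]
    rw [moment_density_eq, moment_density_reflT_two, symmetrised_eq]
  have h2 : 2 * ∫ ξ, F ξ = (∫ ξ, Gcoll r (repr ξ)) + ∫ ξ, Dplat r (repr ξ) := by
    rw [two_mul]
    conv_lhs => rw [hsym]; rw [← hsym]
    nth_rewrite 2 [hsym]
    rw [← integral_add hFi hFri, ← integral_add hGi hDi]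
    exact integral_congr_ae (ae_of_all _ hsum)
  -- (2) the collar part integrates to zero by the `x`-reflection
  have hcoll : ∫ ξ, Gcoll r (repr ξ) = 0 := by
    have hodd : ∀ ξ, Gcoll r (repr (reflT 0 ξ)) = -Gcoll r (repr ξ) := fun ξ => by
      unfold Gcoll bracket
      exact Gcoll_reflT_zero r ξ
    have h := integral_comp_reflT 0 (fun ξ => Gcoll r (repr ξ))
    simp only [hodd, integral_neg] at h
    linarith
  -- (3) the plateau part is positive
  have hplat : 0 < ∫ ξ, Dplat r (repr ξ) := by
    rw [integral_comp_repr (Dplat r)]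
    exact setIntegral_Dplat_pos hr
  have : 0 < 2 * ∫ ξ, F ξ := by rw [h2, hcoll, zero_add]; exact hplat
  linarith

/-! ## 6. Through the door: the all-`q` kill-all -/

/-- **ALL-`q` KILL-ALL (K1-Q2), kernel form.** For every real `q > 2` and every `C`, the
middle-eigenvalue moment rate law `dZ_q/dt ≤ C‖λ₂⁺(S)‖_∞ Z_q` (`MiddleEigenvalueMomentRateBound q C`,
K0 rows `E.q|T_C|C3b`) fails on `T³`: the spiral-jet field has `λ₂(S) ≡ 0` and
`q∫(|ω|²)^{q/2−1}σ > 0`, contradicting the static consequence of the law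
(door `middleEigenvalueMomentRateFailsReal_of_nonpos_middle`). Search for candidate a priori
estimates; no regularity claim. [ours] -/
theorem not_middleEigenvalueMomentRateBound_rpow {q : ℝ} (hq : 2 < q) (C : ℝ) :
    ¬ MiddleEigenvalueMomentRateBound (d := Fin 3) q C := by
  have hr : 0 < q / 2 - 1 := by linarith
  have hpos : 0 < q * ∫ x, torusVorticitySqAt sfld x ^ (q / 2 - 1) * torusStretchingDensity sfld x :=
    mul_pos (by linarith) (integral_moment_pos hr)
  exact middleEigenvalueMomentRateFailsReal_of_nonpos_middle hq.le (Fintype.card_fin 3)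
    isSmooth_sfld isDivFree_sfld middle_nonpos_sfld hpos C

/-- **The K1-Q2 family has exactly one true member**: `∀ q > 2, ∀ C, ¬ MiddleEigenvalueMomentRateBound q C`
(and `q = 2`, `C = 2` holds: tree `middleEigenvalueMomentRateBound_two`). [ours] -/
theorem middleEigenvalueMomentRate_killAll_rpow :
    ∀ q : ℝ, 2 < q → ∀ C : ℝ, ¬ MiddleEigenvalueMomentRateBound (d := Fin 3) q C :=
  fun _ hq C => not_middleEigenvalueMomentRateBound_rpow hq C

/-- Row **`E.q=5/2|T_C|C3b`** (kernel): `∀ C, ¬ MiddleEigenvalueMomentRateBound (5/2) C`. [ours] -/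
theorem middleEigenvalueMomentRate_five_halves_killAll :
    ∀ C : ℝ, ¬ MiddleEigenvalueMomentRateBound (d := Fin 3) (5 / 2) C :=
  middleEigenvalueMomentRate_killAll_rpow _ (by norm_num)

/-- Row **`E.q=3|T_C|C3b`** (kernel): `∀ C, ¬ MiddleEigenvalueMomentRateBound 3 C`. [ours] -/
theorem middleEigenvalueMomentRate_three_killAll :
    ∀ C : ℝ, ¬ MiddleEigenvalueMomentRateBound (d := Fin 3) 3 C :=
  middleEigenvalueMomentRate_killAll_rpow _ (by norm_num)

/-- Row **`E.q=10/3|T_C|C3b`** (kernel): `∀ C, ¬ MiddleEigenvalueMomentRateBound (10/3) C`. [ours] -/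
theorem middleEigenvalueMomentRate_ten_thirds_killAll :
    ∀ C : ℝ, ¬ MiddleEigenvalueMomentRateBound (d := Fin 3) (10 / 3) C :=
  middleEigenvalueMomentRate_killAll_rpow _ (by norm_num)

/-- Row **`E.q=5|T_C|C3b`** (kernel): `∀ C, ¬ MiddleEigenvalueMomentRateBound 5 C`. [ours] -/
theorem middleEigenvalueMomentRate_five_killAll :
    ∀ C : ℝ, ¬ MiddleEigenvalueMomentRateBound (d := Fin 3) 5 C :=
  middleEigenvalueMomentRate_killAll_rpow _ (by norm_num)

/-- **The K1-Q2 family `{dZ_q/dt ≤ C‖λ₂⁺(S)‖_∞Z_q : q ≥ 2}` has EXACTLY ONE true member, `q = 2`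
(kernel):** for real `q ≥ 2`, some constant works iff `q = 2` (Betchov–Miller `C = 2`, tree
`middleEigenvalueMomentRateBound_two`; every `q > 2` is killed by the spiral-jet field). Search for
candidate a priori estimates; no regularity claim. [ours] -/
theorem exists_middleEigenvalueMomentRateBound_iff {q : ℝ} (hq : 2 ≤ q) :
    (∃ C : ℝ, MiddleEigenvalueMomentRateBound (d := Fin 3) q C) ↔ q = 2 := by
  refine ⟨fun ⟨C, hC⟩ => ?_, fun h => ⟨2, by rw [h]; exact middleEigenvalueMomentRateBound_two⟩⟩
  by_contra hne
  exact not_middleEigenvalueMomentRateBound_rpow (lt_of_le_of_ne hq (Ne.symm hne)) C hC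

end SpiralJet

end Summit.NavierStokesRegularity.FunctionalMining

end
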